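import Mathlib
import Summits.PneNP.PneNP.Theses.AeaCutRectangles
import Summits.PneNP.PneNP.Theorems.FoolingMeasure.Negative.FoolingMeasureFalseOfHalfSparseCore

/-!
# Sketch — near-miss character circulants (crux-ideate seat 1 g3, stmt-PneNP-19727 `FoolingMeasure`)

First lemmas of the idea card `nearmiss-character-circulants`.  FRONTIER restricted-model rung; nothing here
bears on P vs NP.
-/

namespace Summit.PneNP.PneNP.Cruxes.FoolingMeasure.NearMissCirculants

open Finset SimpleGraph
open Summit.PneNP.PneNP.Theorems.AeaCutRectanglesDutyRectangles
open Summit.PneNP.PneNP.Theorems.FoolingMeasure.Negative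

/-- The character colouring candidate `χ_u(x) = ((u·x) mod n) mod 3` on `Fin n`. -/
def charColour {n : ℕ} (u x : Fin n) : Fin 3 := ⟨(u * x).val % 3, Nat.mod_lt _ (by decide)⟩

/-- `S ⊆ Fin n` is a NEAR-MISS connection set: `1 ∈ S`, every element is coprime to `n`, and every ordered
ratio `s / s'` (`s ≠ s'`) is represented by an integer `≡ 2 (mod 3)` in `[0,n)`. -/
def NearMiss (n : ℕ) [NeZero n] (S : Finset (Fin n)) : Prop :=
  (1 : Fin n) ∈ S ∧ (∀ s ∈ S, Nat.Coprime s.val n) ∧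
    ∀ s ∈ S, ∀ s' ∈ S, s ≠ s' → ∃ r : Fin n, r * s' = s ∧ r.val % 3 = 2

/-- CHARACTER LEMMA: for `n ≡ 1 (mod 3)`, `χ_u` is a proper colouring of the circulant `C(n; ±S)` iff every
`(u·s mod n) ≡ 2 (mod 3)`; and if `(u·s_j mod n) = 1` while `(u·s mod n) ≡ 2 (mod 3)` for the other `s`, then
`χ_u` has exactly one monochromatic edge (proof: across an edge `x → x+s` the value `u·x mod n` moves by
`a = u·s mod n` without wrap or by `a − n ≡ a − 1 (mod 3)` with wrap). -/
def CharProperIff : Prop :=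
  ∀ (n : ℕ) [NeZero n], n % 3 = 1 → ∀ S : Finset (Fin n), (0 : Fin n) ∉ S → ∀ u : Fin n, Nat.Coprime u.val n →
    ((∀ x y : Fin n, (circulantGraph (S : Set (Fin n))).Adj x y → charColour u x ≠ charColour u y) ↔
      ∀ s ∈ S, (u * s).val % 3 = 2)

/-- FIRST LEMMA (near-miss criterion).  For `n ≡ 1 (mod 3)` and a near-miss `S`, deleting ANY one edge of
`C(n; ±S)` leaves a 3-colourable graph (the character `χ_{1/s_j}` has a single monochromatic edge, in class
`s_j`, and translations move it onto any prescribed edge of that class).  Hence `C(n; ±S)` is 4-critical iff it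
is not 3-colourable. -/
def NearMissCriterion : Prop :=
  ∀ (n : ℕ) [NeZero n], n % 3 = 1 → ∀ S : Finset (Fin n), NearMiss n S →
    ∀ x y : Fin n, (circulantGraph (S : Set (Fin n))).Adj x y →
      ((circulantGraph (S : Set (Fin n))).deleteEdges {s(x, y)}).Colorable 3

/-- WINDOW LEMMA (the rigidity mechanism, elementary): three consecutive integers of the same parity
(`a, a+2, a+4`) contain a multiple of `3`; so along a 3-colouring `c` of `C(n; ±S)` with `1 ∈ S`, for each
`s ∈ S` the sliding sums of the `±1`-word `∂c` over windows of length `s` take at most TWO values. -/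
theorem window_lemma (a : ℤ) : 3 ∣ a ∨ 3 ∣ (a + 2) ∨ 3 ∣ (a + 4) := by omega


/-- **REGULAR 3-COLOURING THEOREM (R3T; this seat, elementary, brute-force verified for all circulants with
`1 ∈ D`, `|D| ≤ 5`, `n ≤ 27`, and consistent with 51/51 SAT runs of kit j292331).**  A circulant whose
connection set contains the unit `1` is 3-colourable iff it has a proper REGULAR (arc / multiplier)
3-colouring `x ↦ ⌊3·(t·x mod n)/n⌋`, i.e. iff some multiplier `t` puts every `t·d mod n` in the middle third
`[n/3, 2n/3]` (Zhu's `κ(n, D) ≥ 1/3`).  Proof: the derivative of a 3-colouring along the Hamilton cycle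
`x ↦ x+1` is a `±1` word; by `window_lemma` its sliding sums over each window length `d ∈ D` take at most two
values `{a, a+2}` avoiding `0 (mod 3)`; these values are determined by the number `P` of `+1`s alone, so the
mechanical (Christoffel) word with `P` plus-signs is also a proper derivative, and it integrates to the arc
colouring with `t = (n + P)/3`. -/
def RegularThreeColouring : Prop :=
  ∀ (n : ℕ) [NeZero n], 3 ≤ n → ∀ D : Finset (Fin n), (1 : Fin n) ∈ D → (0 : Fin n) ∉ D →
    ((circulantGraph (D : Set (Fin n))).Colorable 3 ↔
      ∃ t : Fin n, ∀ d ∈ D, n ≤ 3 * (t * d).val ∧ 3 * (t * d).val ≤ 2 * n)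

/-- COROLLARY (explicit regular 4-critical graphs): for `n ≡ 1 (mod 3)` and a near-miss `S` admitting no
middle-third multiplier, `C(n; ±S)` is a `2|S|`-regular 4-critical graph (`RegularThreeColouring` gives
non-3-colourability, `NearMissCriterion` criticality of every edge).  Instances found by kit j292331:
42 distinct graphs of degrees 6, 8, 10, 12 on 97 … 3379 vertices (e.g. `C(97; ±{1,11,38})`,
`C(2419; ±{1,65,317,653,665,1097})`). -/
def NearMissFourCritical : Prop :=
  ∀ (n : ℕ) [NeZero n], 3 ≤ n → n % 3 = 1 → ∀ S : Finset (Fin n), NearMiss n S →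
    (¬ ∃ t : Fin n, ∀ s ∈ S, n ≤ 3 * (t * s).val ∧ 3 * (t * s).val ≤ 2 * n) →
    ¬ (circulantGraph (S : Set (Fin n))).Colorable 3 ∧
      ∀ x y : Fin n, (circulantGraph (S : Set (Fin n))).Adj x y →
        ((circulantGraph (S : Set (Fin n))).deleteEdges {s(x, y)}).Colorable 3

theorem nearMissFourCritical_of (h₁ : RegularThreeColouring) (h₂ : NearMissCriterion) :
    NearMissFourCritical := by
  intro n _ h3 hn S hS hno
  refine ⟨fun hcol => hno ?_, fun x y hxy => h₂ n hn S hS x y hxy⟩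
  have h0 : (0 : Fin n) ∉ S := by
    intro h0
    obtain ⟨-, hcop, -⟩ := hS
    have h := hcop 0 h0
    simp only [Fin.val_zero, Nat.coprime_zero_left] at h
    omega
  exact (h₁ n h3 S hS.1 h0).1 hcol

/-- (Former strong rigidity conjecture "every proper 3-colouring of a near-miss circulant is a character
colouring up to `S₃`" is FALSE: kit j292831 found a non-character proper 3-colouring for every one of the
2855 character-colourable near-miss instances with `k ≤ 5`, `n ≤ 1000` — always with two-valued window sums
`{a, a+2}`, `a ≡ 2 (mod 3)`, exactly the freedom the proof of `RegularThreeColouring` allows.  The WEAK form —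
existence of a proper 3-colouring transfers to a character/regular colouring — is `RegularThreeColouring`
above and is what the corollary uses.)  `NonCharacterColouringsExist` records the refuting phenomenon. -/
def NonCharacterColouringsExist : Prop :=
  ∃ n : ℕ, ∃ _ : NeZero n, ∃ S : Finset (Fin n), NearMiss n S ∧
    ∃ c : (circulantGraph (S : Set (Fin n))).Coloring (Fin 3),
      ∀ u : Fin n, ∀ σ : Equiv.Perm (Fin 3), ∃ x, c x ≠ σ (charColour u x)

/-- SPECTRAL HALF-DENSITY CERTIFICATE: a quadratic-form lower bound `lam` for the adjacency matrix on
mean-zero vectors gives, for a `d`-regular graph, `e(T) ≥ (d·|T|²/n + lam·|T|·(n−|T|)/n)/2` for every vertex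
set `T`; at `|T| = ⌈n/2⌉` this is `> n/2` as soon as `lam > 4 − d` (with room).  For circulants the
eigenvalues are the character sums `λ_t = Σ_{c ∈ ±S} cos(2π t c/n)`
(`Literature.Combinatorics.SimpleGraph.CayleyGraphSpectrum.adjMatrix_circulantGraph_mulVec_addChar`). -/
def SpectralHalfDensity : Prop :=
  ∀ (n d : ℕ) (G : SimpleGraph (Fin n)) [DecidableRel G.Adj] (lam : ℝ), G.IsRegularOfDegree d →
    (∀ v : Fin n → ℝ, ∑ i, v i = 0 → lam * ∑ i, v i ^ 2 ≤ ∑ i, ∑ j, G.adjMatrix ℝ i j * v i * v j) →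
    ∀ T : Finset (Fin n),
      ((d : ℝ) * (T.card : ℝ) ^ 2 / n + lam * T.card * ((n : ℝ) - T.card) / n) / 2
        ≤ ((G.edgeFinset.filter fun e => ∀ v ∈ e, v ∈ T).card : ℝ)

/-- A HALF-DENSE 4-CRITICAL TEMPLATE in the language of `HalfSparseCore`: a loopless, non-3-colourable,
edge-critical edge set every `≥ n/2`-vertex set of which spans `> n/2` edges. -/
def HDCTemplate : Prop :=
  ∃ (n : ℕ) (G : Finset (Sym2 (Fin n))), (∀ e ∈ G, ¬ e.IsDiag) ∧
    ¬ (fromEdgeSet (G : Set (Sym2 (Fin n)))).Colorable 3 ∧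
    (∀ F, F ⊆ G → ¬ (fromEdgeSet (F : Set (Sym2 (Fin n)))).Colorable 3 → F = G) ∧
    ∀ S : Finset (Fin n), n ≤ 2 * S.card → n < 2 * (bobSide S G).card

/-- TRANSFER (proved): one half-dense 4-critical template refutes `HalfSparseCore`, i.e. removes the
hypothesis of the conditional kill `foolingMeasure_false_of_halfSparseCore` (p570033). -/
theorem hdcTemplate_not_halfSparseCore (h : HDCTemplate) : ¬ HalfSparseCore := by
  intro hH
  obtain ⟨n, G, hloop, hcol, hcrit, hdense⟩ := h
  obtain ⟨S, hS, F, hFG, hF, hFS⟩ := hH n G hloop hcol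
  have hFeq : F = G := hcrit F hFG hF
  subst hFeq
  have := hdense S hS
  omega

/-- THE LINE'S TARGET (arithmetic form): some near-miss circulant with `n ≡ 1 (mod 3)` is not
3-colourable and every `⌈n/2⌉`-set spans `> n/2` of its edges.  With `NearMissCriterion` this yields
`HDCTemplate`. -/
def NearMissTemplate : Prop :=
  ∃ (n : ℕ) (_ : NeZero n), n % 3 = 1 ∧ ∃ S : Finset (Fin n), NearMiss n S ∧
    ¬ (circulantGraph (S : Set (Fin n))).Colorable 3 ∧
    ∀ T : Finset (Fin n), n ≤ 2 * T.card →
      n < 2 * ((circulantGraph (S : Set (Fin n))).edgeFinset.filter fun e => ∀ v ∈ e, v ∈ T).card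


/-! ## The explicit witness (kit j293256, 2026-08-27): `C(5371; ±{1, 332, 728, 1745, 2567})`

`332 + 728 + 1745 + 2567 = 5371 + 1`, so the five classes carry the signed zero-sum relation
`1 − 332 − 728 − 1745 − 2567 ≡ 0 (mod 5371)`: the `5371` closed walks
`x, x+1, x+1−332, x+1−332−2567, x+1−332−2567−728, x` are pairwise edge-disjoint 5-cycles, one edge from each
class, every vertex on exactly five of them.  A `j`-subset of a 5-cycle spans `≥ j − 2` of its edges, hence
`e(T) ≥ 5|T| − 2·5371` for every vertex set `T`, i.e. `≥ 2688 > 2685.5` once `|T| ≥ 2686` (HALF-DENSITY, no search,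
no certificate).  The set is near-miss (every class has a one-defect character colouring ⇒ edge-critical) and has no
middle-third multiplier (⇒ not 3-colourable by `RegularThreeColouring`; CaDiCaL independently: UNSAT); so the graph is a
10-regular 4-critical graph all of whose halves are dense: `HDCTemplate` holds and `HalfSparseCore` is false.
Below: the three certificate obligations as named statements and the (proved) assembly. -/
section PentagonWitness

/-- the modulus of the witness. -/
abbrev Np : ℕ := 5371

/-- connection set of the witness. -/
def pentaS : Finset (Fin Np) := {1, 332, 728, 1745, 2567}

/-- the witness graph `C(5371; ±{1,332,728,1745,2567})`. -/
def pentaG : SimpleGraph (Fin Np) := circulantGraph (pentaS : Set (Fin Np))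

instance pentaG.decAdj : DecidableRel pentaG.Adj := by
  unfold pentaG circulantGraph; infer_instance

/-- its edge set as a `Finset (Sym2 (Fin 5371))` (the form `HalfSparseCore` speaks about). -/
def pentaEdges : Finset (Sym2 (Fin Np)) := pentaG.edgeFinset

/-- the zero-sum pentagon relation. -/
theorem penta_relation : (1 : Fin Np) - 332 - 2567 - 728 - 1745 = 0 := by decide

/-- OBLIGATION 1 (non-3-colourability; route: `RegularThreeColouring` + `penta_noMiddleThird`, or a SAT certificate). -/
def PentaNotColorable : Prop := ¬ pentaG.Colorable 3

/-- the arithmetic half of obligation 1: no multiplier puts all five classes in the middle third. -/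
def PentaNoMiddleThird : Prop :=
  ¬ ∃ t : Fin Np, ∀ d ∈ pentaS, Np ≤ 3 * (t * d).val ∧ 3 * (t * d).val ≤ 2 * Np

theorem pentaNotColorable_of_R3T (hR : RegularThreeColouring) (hNC : PentaNoMiddleThird) :
    PentaNotColorable := by
  intro hcol
  have h1 : (1 : Fin Np) ∈ pentaS := by decide
  have h0 : (0 : Fin Np) ∉ pentaS := by decide
  exact hNC ((hR Np (by norm_num) pentaS h1 h0).1 hcol)

/-- OBLIGATION 2 (criticality in the form `HDCTemplate` needs): every non-3-colourable edge subset is everything.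
Route: for each of the five classes the one-defect character colouring `x ↦ ((u·x) mod 5371) mod 3`, `u = s_j⁻¹`,
is a proper 3-colouring of `pentaG` minus ONE edge of class `s_j` (near-miss property, checked: exactly one bad edge),
and translations are automorphisms; so `G − e` is 3-colourable for every edge `e`, whence `F ⊊ G ⇒ F` 3-colourable. -/
def PentaCritical : Prop :=
  ∀ F, F ⊆ pentaEdges → ¬ (fromEdgeSet (F : Set (Sym2 (Fin Np)))).Colorable 3 → F = pentaEdges

/-- OBLIGATION 3 (half-density): every vertex set of size `≥ 2686` spans `≥ 2686` edges (in fact `≥ 5|T| − 10742`).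
Route: `PentagonSystemBound` with the 5371 relation pentagons. -/
def PentaHalfDense : Prop :=
  ∀ T : Finset (Fin Np), Np ≤ 2 * T.card → Np < 2 * (bobSide T pentaEdges).card

/-- ODD-CYCLE SYSTEM BOUND, pentagon case (general, elementary double counting): pairwise edge-disjoint 5-cycles
`P i` inside an edge set `G` give `e_G(T) ≥ Σ_i (|P i ∩ T| − 2)` for every vertex set `T`. -/
def PentagonSystemBound : Prop :=
  ∀ (n m : ℕ) (G : Finset (Sym2 (Fin n))) (P : Fin m → Fin 5 → Fin n),
    (∀ i, Function.Injective (P i)) →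
    (∀ i (j : Fin 5), s(P i j, P i (j + 1)) ∈ G) →
    (∀ i i' (j j' : Fin 5), s(P i j, P i (j + 1)) = s(P i' j', P i' (j' + 1)) → i = i') →
    ∀ T : Finset (Fin n),
      (∑ i, (((Finset.univ.filter fun j => P i j ∈ T).card : ℤ) - 2)) ≤ ((bobSide T G).card : ℤ)

/-- ASSEMBLY (proved): the three obligations make the witness an `HDCTemplate` … -/
theorem penta_hdcTemplate (h1 : PentaNotColorable) (h2 : PentaCritical) (h3 : PentaHalfDense) :
    HDCTemplate := by
  refine ⟨Np, pentaEdges, ?_, ?_, h2, h3⟩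
  · intro e he
    have he' : e ∈ pentaG.edgeSet := by simpa [pentaEdges] using he
    exact SimpleGraph.not_isDiag_of_mem_edgeSet _ he'
  · have hG : fromEdgeSet ((pentaEdges : Set (Sym2 (Fin Np)))) = pentaG := by
      simp [pentaEdges]
    rw [hG]; exact h1

/-- … and therefore refute `HalfSparseCore` (the hypothesis of the standing conditional kill p570033). -/
theorem penta_not_halfSparseCore (h1 : PentaNotColorable) (h2 : PentaCritical) (h3 : PentaHalfDense) :
    ¬ HalfSparseCore :=
  hdcTemplate_not_halfSparseCore (penta_hdcTemplate h1 h2 h3)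

end PentagonWitness

end Summit.PneNP.PneNP.Cruxes.FoolingMeasure.NearMissCirculants
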